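import Literature.AlgebraicGeometry.Resolution.EmbeddedCurvePointBlowups
import Literature.AlgebraicGeometry.Resolution.PointBlowupIntersectionMultiplicityFinite
import Literature.AlgebraicGeometry.Resolution.StrictTransformSupport
import Literature.AlgebraicGeometry.Resolution.AlterationsNodalBoundary
import HarnessLib

/-!
# Configurations of curves under the blowing up of a point, I: the strict transform of one curve

Topic: `Literature/AlgebraicGeometry/Resolution`. First of four files formalising the PURE CURVE-CONFIGURATION
part of steps 1–2 of the algorithm of Cossart–Piltant, *Resolution of singularities of threefolds in positive
characteristic I*, J. Algebra 320 (2008), proof of Prop. 4.4 (p. 10: «1- If `Σ(i)` has an irreducible component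
of dimension one which is singular, let `X(i+1)` be the blowing up of `X(i)` along any such singular point …
2- If `Σ(i)` has regular components of dimension one which do not intersect transversally, let `X(i+1)` be the
blowing up of `X(i)` along any such non-transverse intersection point … By embedded resolution of curves, we have
`s(i) ≥ 2` for `i >> 0` … By embedded resolution of (reducible) curves, we have `s(i) ≥ 3` for `i >> 0`»), with
the termination measure of The Stacks Project, Tag 0BIC (Lemma 54.15.6, proof ¶2: the `δ`-invariants, then the
intersection multiplicities of Tag 0BI6, which drop by Tag 0BI7). The theorem is
`false_of_badPointChain_of_curveConfiguration` (`EmbeddedCurveConfigurationPointBlowups.lean`); the consumer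
is the F-71 line of cell res-hironaka (`CossartPiltant2008_prop44`), which identifies the configurations with
the one-dimensional components of the singular locus `Σ` (CP Lemma 4.3) — NOT done here.

CURRENCY. A curve on a scheme `X` is a closed subset `C : Closeds X` whose reduced induced closed subscheme
`V(𝓘_C) = (vanishingIdeal C).subscheme` is integral (and, where needed, Noetherian, quasi-excellent, of
dimension one); the blowing up `π : X' → X` of the closed point `x` is given by the universal property
(`IsBlowup π 𝓘_{x}`, `Blowups.lean`); the strict transform of `C` is the closed set `closure (π⁻¹(C ∖ {x}))`.

This file (kernel-checked assembly of tree results, no new definitions):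
* `strictTransformIdeal_vanishingIdeal_eq` — **`σᶜ(𝓘_C) = 𝓘_{C̃}`**: the schematic strict transform
  (`strictTransformIdeal`, Görtz–Wedhorn I (13.19); Stacks Tag 080D) of the ideal of a reduced irreducible curve
  is the ideal of the topological strict transform `C̃ = closure (π⁻¹(C ∖ {x}))` — because `V(σᶜ(𝓘_C))` is the
  blowing up of the integral curve `V(𝓘_C)` in the pulled-back point (Tag 080E,
  `isBlowup_lift_subschemeι_strictTransformIdeal`), hence integral (Tag 02ND), so its ideal is radical
  (`radical_eq_of_isReduced_subscheme`) and equals the vanishing ideal of its support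
  (`support_strictTransformIdeal_eq_closure`, Mathlib `vanishingIdeal_support`); this is the bridge between the
  set-theoretic currency of Cossart–Piltant and the ideal-theoretic one of `Stacks0BI7_core`;
* `isIntegral_subscheme_vanishingIdeal_strictTransform` — `V(𝓘_{C̃})` is integral;
* `finsum_pointDelta_strictTransform_le_and_lt` — **`Σ_y δ(𝒪_{C̃,y}) ≤ Σ_y δ(𝒪_{C,y})`, with `<` when `x` is a
  singular point of `C`** (`IsBlowup.finsum_pointDelta_strictTransform_lt`, Kollár 2007 §1.4 / Liu 9.2.32; at a
  regular centre point or off the curve `C̃ ≅ C`, Tag 0BI7 (1));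
* small lemmas on the points of `V(𝓘_C)` over a closed point of `X` (closed, not generic, local ring not a
  field; Stacks Tag 0BI3) and on the topological strict transform off the exceptional fibre.

AI-written; weaker than expert review. Not a statement of any manuscript under review; F-71 is NOT discharged by
this file; no summit statement is proved.

## References
* V. Cossart, O. Piltant, J. Algebra 320 (2008) 1051–1082, Prop. 4.4 (proof, p. 10). [CossartPiltant2008]
* The Stacks Project, Tags 0BI3, 0BI7, 0BIC, 080D, 080E, 02ND, 02OS. [StacksProject]
* U. Görtz, T. Wedhorn, *Algebraic Geometry I*, 2nd ed. (2020), (13.19) p. 414. [GortzWedhorn2020]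
* J. Kollár, *Lectures on Resolution of Singularities* (2007), §1.4. [Kollar2007]
-/

noncomputable section

open CategoryTheory AlgebraicGeometry TopologicalSpace IsLocalRing

universe u

namespace Literature.AlgebraicGeometry.Resolution

open Scheme.IdealSheafData

namespace CurveConfiguration

variable {X X' : Scheme.{u}} {π : X' ⟶ X} {x : X} {hx : IsClosed ({x} : Set X)}

/-! ## The topological strict transform of a closed set under the blowing up of a point -/

/-- The support of the schematic strict transform `σᶜ(𝓘_C)` of the reduced closed set `C` under the blowing
up of the point `x` is the topological strict transform `closure (π⁻¹(C ∖ {x}))`.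
[cite: GortzWedhorn2020, (13.19) p. 414] -/
theorem coe_support_strictTransformIdeal_vanishingIdeal [IsLocallyNoetherian X'] (C : Closeds X) :
    ((strictTransformIdeal π (vanishingIdeal ⟨{x}, hx⟩) (vanishingIdeal C)).support : Set X') =
      closure (π ⁻¹' ((C : Set X) \ {x})) := by
  rw [support_strictTransformIdeal_eq_closure, coe_support_vanishingIdeal, coe_support_vanishingIdeal]
  rfl

/-- Off the exceptional fibre the topological strict transform of `C` is `π⁻¹(C)`: for `π q ≠ x`,
`q ∈ closure (π⁻¹(C ∖ {x})) ↔ π q ∈ C`. [cite: GortzWedhorn2020, (13.19) p. 414] -/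
theorem mem_closure_preimage_diff_iff (hπc : Continuous π) (C : Closeds X) {q : X'} (hq : π q ≠ x) :
    q ∈ closure (π ⁻¹' ((C : Set X) \ {x})) ↔ π q ∈ (C : Set X) := by
  constructor
  · intro h
    have hsub : closure (π ⁻¹' ((C : Set X) \ {x})) ⊆ π ⁻¹' (C : Set X) :=
      closure_minimal (Set.preimage_mono Set.sdiff_subset) (C.isClosed.preimage hπc)
    exact hsub h
  · intro h
    exact subset_closure ⟨h, hq⟩

/-- If `x ∉ C` the topological strict transform of `C` does not meet the exceptional fibre. [cite: GortzWedhorn2020, (13.19) p. 414] -/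
theorem closure_preimage_diff_inter_preimage_singleton_eq_empty (hπc : Continuous π) (C : Closeds X)
    (hxC : x ∉ (C : Set X)) :
    closure (π ⁻¹' ((C : Set X) \ {x})) ∩ π ⁻¹' {x} = ∅ := by
  have hdiff : (C : Set X) \ {x} = C := Set.sdiff_singleton_eq_self hxC
  rw [hdiff, (C.isClosed.preimage hπc).closure_eq, ← Set.preimage_inter, Set.eq_empty_iff_forall_notMem]
  rintro q ⟨hqC, hqx⟩
  rw [Set.mem_singleton_iff] at hqx
  exact hxC (hqx ▸ hqC)

/-! ## Curves: integral one-dimensional reduced closed subschemes -/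

section Curve

variable {Y : Scheme.{u}} [IsIntegral Y]

/-- A closed point of an integral scheme of dimension one is not its generic point. [folklore] -/
private theorem ne_genericPoint_of_isClosed_of_dim_eq_one (hdim : topologicalKrullDim Y = 1) {c : Y}
    (hc : IsClosed ({c} : Set Y)) : c ≠ genericPoint Y := by
  intro h
  have huniv : ({c} : Set Y) = Set.univ := by
    rw [← hc.closure_eq, h]
    exact (genericPoint_spec Y).def
  haveI : Subsingleton Y := ⟨fun a b => by
    have ha : a ∈ ({c} : Set Y) := huniv ▸ Set.mem_univ a
    have hb : b ∈ ({c} : Set Y) := huniv ▸ Set.mem_univ b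
    rw [Set.mem_singleton_iff] at ha hb
    rw [ha, hb]⟩
  have h0 := topologicalKrullDim_zero_of_discreteTopology Y
  rw [hdim] at h0
  exact absurd h0 (by decide)

end Curve

/-- The point of `V(𝓘_C)` over a point of `C` («the unique point of `Y` specializing to `p`»). [cite: StacksProject, Tag 0BI3 (§54.15, situation before Lemma 54.15.3)] -/
theorem exists_subschemeι_eq (C : Closeds X) {p : X} (hp : p ∈ (C : Set X)) :
    ∃ c : (vanishingIdeal C).subscheme, (vanishingIdeal C).subschemeι c = p := by
  rw [← Set.mem_range, range_subschemeι, coe_support_vanishingIdeal]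
  exact hp

/-- Points of `V(𝓘_C)` map into `C`. [cite: StacksProject, Tag 0BI3 (§54.15, situation before Lemma 54.15.3)] -/
theorem subschemeι_mem (C : Closeds X) (c : (vanishingIdeal C).subscheme) :
    (vanishingIdeal C).subschemeι c ∈ (C : Set X) := by
  rw [← coe_support_vanishingIdeal (Z := C), ← range_subschemeι]
  exact ⟨c, rfl⟩

/-- A point of `V(𝓘_C)` over a closed point of `X` is closed. [cite: StacksProject, Tag 0BI3 (§54.15, situation before Lemma 54.15.3)] -/
theorem isClosed_singleton_of_subschemeι_eq (C : Closeds X) {p : X} (hp : IsClosed ({p} : Set X))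
    {c : (vanishingIdeal C).subscheme} (hc : (vanishingIdeal C).subschemeι c = p) :
    IsClosed ({c} : Set (vanishingIdeal C).subscheme) := by
  rw [← preimage_singleton_eq_of_isClosedImmersion (vanishingIdeal C).subschemeι hc]
  exact hp.preimage (vanishingIdeal C).subschemeι.continuous

/-- For an integral one-dimensional `V(𝓘_C)` and a closed point `p = ι c` of `X` on `C`, the generic point of
`V(𝓘_C)` does not lie over `p`. [cite: StacksProject, Tag 0BI3 (§54.15, situation before Lemma 54.15.3)] -/
theorem subschemeι_genericPoint_notMem_singleton (C : Closeds X) [IsIntegral (vanishingIdeal C).subscheme]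
    (hdim : topologicalKrullDim (vanishingIdeal C).subscheme = 1) {p : X} (hp : IsClosed ({p} : Set X))
    {c : (vanishingIdeal C).subscheme} (hc : (vanishingIdeal C).subschemeι c = p) :
    (vanishingIdeal C).subschemeι (genericPoint (vanishingIdeal C).subscheme) ∉
      ((vanishingIdeal ⟨{p}, hp⟩).support : Set X) := by
  rw [coe_support_vanishingIdeal]
  intro h
  have h' : (vanishingIdeal C).subschemeι (genericPoint (vanishingIdeal C).subscheme) =
      (vanishingIdeal C).subschemeι c := by
    rw [hc]; exact h
  exact ne_genericPoint_of_isClosed_of_dim_eq_one hdim (isClosed_singleton_of_subschemeι_eq C hp hc)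
    ((vanishingIdeal C).subschemeι.isClosedEmbedding.injective h').symm

/-- The local ring of an integral one-dimensional `V(𝓘_C)` at a point over a closed point of `X` is not a
field. [cite: StacksProject, Tag 0BI3 (§54.15, situation before Lemma 54.15.3)] -/
theorem not_isField_stalk_of_subschemeι_eq (C : Closeds X) [IsIntegral (vanishingIdeal C).subscheme]
    (hdim : topologicalKrullDim (vanishingIdeal C).subscheme = 1) {p : X} (hp : IsClosed ({p} : Set X))
    {c : (vanishingIdeal C).subscheme} (hc : (vanishingIdeal C).subschemeι c = p) :
    ¬ IsField ((vanishingIdeal C).subscheme.presheaf.stalk c) := by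
  intro hF
  have hm := maximalIdeal_stalk_ne_bot (vanishingIdeal C).subschemeι (vanishingIdeal ⟨{p}, hp⟩) c
    (by rw [hc]; change p ∈ ((vanishingIdeal ⟨{p}, hp⟩).support : Set X)
        rw [coe_support_vanishingIdeal]; exact Set.mem_singleton p)
    (subschemeι_genericPoint_notMem_singleton C hdim hp hc)
  exact hm ((IsLocalRing.isField_iff_maximalIdeal_eq).mp hF)

/-- The pulled-back centre `ι^*𝓘_{x}` on an integral one-dimensional `V(𝓘_C)` is non-zero. [cite: StacksProject, Tag 0BI7 (Lemma 54.15.3, proof)] -/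
theorem comap_subschemeι_vanishingIdeal_singleton_ne_bot (C : Closeds X)
    [IsIntegral (vanishingIdeal C).subscheme] (hdim : topologicalKrullDim (vanishingIdeal C).subscheme = 1) :
    (vanishingIdeal ⟨{x}, hx⟩).comap (vanishingIdeal C).subschemeι ≠ ⊥ := by
  by_cases hxC : x ∈ (C : Set X)
  · obtain ⟨c, hc⟩ := exists_subschemeι_eq C hxC
    exact comap_vanishingIdeal_singleton_ne_bot (vanishingIdeal C).subschemeι hx hc
      (not_isField_stalk_of_subschemeι_eq C hdim hx hc)
  · intro h
    have hsupp : ((((vanishingIdeal ⟨{x}, hx⟩).comap (vanishingIdeal C).subschemeι).support :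
        Set (vanishingIdeal C).subscheme)) = Set.univ := by
      rw [h, Scheme.IdealSheafData.support_bot, Closeds.coe_top]
    rw [Scheme.IdealSheafData.support_comap, Closeds.coe_preimage, coe_support_vanishingIdeal] at hsupp
    have hη : (vanishingIdeal C).subschemeι (genericPoint (vanishingIdeal C).subscheme) ∈ ({x} : Set X) :=
      (hsupp ▸ Set.mem_univ (genericPoint _) : genericPoint _ ∈ (vanishingIdeal C).subschemeι ⁻¹' {x})
    rw [Set.mem_singleton_iff] at hη
    exact hxC (hη ▸ subschemeι_mem C _)

/-- **The schematic strict transform of a reduced irreducible curve is reduced: `σᶜ(𝓘_C) = 𝓘_{C̃}`**, the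
ideal sheaf of the topological strict transform `C̃ = closure (π⁻¹(C ∖ {x}))` — the strict transform
`V(σᶜ(𝓘_C))` is the blowing up of the integral curve `V(𝓘_C)` in `ι^*𝓘_{x}` (Stacks Tag 080E), an integral
scheme (Tag 02ND), so its ideal is radical, i.e. the vanishing ideal of its support.
[cite: StacksProject, Tag 080E] [cite: GortzWedhorn2020, (13.19) p. 414] -/
theorem strictTransformIdeal_vanishingIdeal_eq [IsLocallyNoetherian X] [IsLocallyNoetherian X']
    (hπ : IsBlowup π (vanishingIdeal ⟨{x}, hx⟩)) (C : Closeds X) [IsIntegral (vanishingIdeal C).subscheme]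
    (hdim : topologicalKrullDim (vanishingIdeal C).subscheme = 1) :
    strictTransformIdeal π (vanishingIdeal ⟨{x}, hx⟩) (vanishingIdeal C) =
      vanishingIdeal ⟨closure (π ⁻¹' ((C : Set X) \ {x})), isClosed_closure⟩ := by
  have hρ := isBlowup_lift_subschemeι_strictTransformIdeal hπ (vanishingIdeal C).subschemeι
  haveI : IsIntegral (strictTransformIdeal π (vanishingIdeal ⟨{x}, hx⟩)
      (vanishingIdeal C).subschemeι.ker).subscheme :=
    hρ.isIntegral (comap_subschemeι_vanishingIdeal_singleton_ne_bot C hdim)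
  have hrad := radical_eq_of_isReduced_subscheme
    (strictTransformIdeal π (vanishingIdeal ⟨{x}, hx⟩) (vanishingIdeal C).subschemeι.ker)
  rw [ker_subschemeι] at hrad
  rw [← hrad, ← vanishingIdeal_support]
  congr 1
  ext1
  exact coe_support_strictTransformIdeal_vanishingIdeal C

/-- **The reduced strict transform `V(𝓘_{C̃})` of an integral curve is integral** (it is the blowing up of
`V(𝓘_C)` in the pulled-back point, Stacks Tags 080E, 02ND). [cite: StacksProject, Tag 080E] -/
theorem isIntegral_subscheme_vanishingIdeal_strictTransform [IsLocallyNoetherian X] [IsLocallyNoetherian X']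
    (hπ : IsBlowup π (vanishingIdeal ⟨{x}, hx⟩)) (C : Closeds X) [IsIntegral (vanishingIdeal C).subscheme]
    (hdim : topologicalKrullDim (vanishingIdeal C).subscheme = 1) :
    IsIntegral (vanishingIdeal (⟨closure (π ⁻¹' ((C : Set X) \ {x})), isClosed_closure⟩ : Closeds X')).subscheme := by
  have hρ := isBlowup_lift_subschemeι_strictTransformIdeal hπ (vanishingIdeal C).subschemeι
  have h : IsIntegral (strictTransformIdeal π (vanishingIdeal ⟨{x}, hx⟩)
      (vanishingIdeal C).subschemeι.ker).subscheme :=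
    hρ.isIntegral (comap_subschemeι_vanishingIdeal_singleton_ne_bot C hdim)
  have heq : strictTransformIdeal π (vanishingIdeal ⟨{x}, hx⟩) (vanishingIdeal C).subschemeι.ker =
      vanishingIdeal (⟨closure (π ⁻¹' ((C : Set X) \ {x})), isClosed_closure⟩ : Closeds X') := by
    rw [ker_subschemeι]; exact strictTransformIdeal_vanishingIdeal_eq hπ C hdim
  exact heq ▸ h

/-! ## The `δ`-invariant of the strict transform -/

/-- The total `δ`-invariant of an integral Noetherian quasi-excellent curve is finite. [cite: Kollar2007, §1.4] -/
theorem finsum_pointDelta_ne_top {Y : Scheme.{u}} [IsIntegral Y] [IsNoetherian Y] (hqe : Scheme.IsQuasiExcellent Y)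
    (hdim : topologicalKrullDim Y ≤ 1) : ∑ᶠ y, pointDelta Y y ≠ ⊤ := by
  rw [finsum_eq_sum _ (finite_support_pointDelta hqe hdim)]
  exact ENat.sum_ne_top.mpr fun y _ => pointDelta_ne_top hqe hdim y

/-- **`Σ δ` of the strict transform of a curve never increases, and drops at a singular centre.** For the
blowing up `π` of `X` at the closed point `x`, a closed set `C ⊆ X` whose reduced subscheme `V(𝓘_C)` is an
integral Noetherian quasi-excellent curve, and `K = σᶜ(𝓘_C)` the ideal of its strict transform (whose
subscheme `V(K) = Bl_{ι^*𝓘_x} V(𝓘_C)` is assumed integral — it is): `Σ_{y'} δ(𝒪_{V(K),y'}) ≤ Σ_y δ(𝒪_{V(𝓘_C),y})`,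
with strict inequality when `x` is a singular point of `V(𝓘_C)` (Cossart–Piltant 2008, proof of Prop. 4.4,
step 1; the equality case: at a regular centre point `V(K) ≅ V(𝓘_C)`, Stacks Tag 0BI7 (1)).
[cite: CossartPiltant2008, Prop. 4.4 (proof, p. 10, step 1)] [cite: StacksProject, Tag 0BI7 (Lemma 54.15.3 (1))] -/
theorem finsum_pointDelta_strictTransform_le_and_lt [IsLocallyNoetherian X] [IsLocallyNoetherian X']
    (hπ : IsBlowup π (vanishingIdeal ⟨{x}, hx⟩)) (C : Closeds X) [IsIntegral (vanishingIdeal C).subscheme]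
    [IsNoetherian (vanishingIdeal C).subscheme] (hqe : Scheme.IsQuasiExcellent (vanishingIdeal C).subscheme)
    (hdim : topologicalKrullDim (vanishingIdeal C).subscheme = 1)
    (K : X'.IdealSheafData)
    (hK : strictTransformIdeal π (vanishingIdeal ⟨{x}, hx⟩) (vanishingIdeal C).subschemeι.ker = K)
    [IsIntegral K.subscheme] :
    ∑ᶠ y', pointDelta K.subscheme y' ≤ ∑ᶠ y, pointDelta (vanishingIdeal C).subscheme y ∧
    (x ∈ (vanishingIdeal C).subschemeι '' (Scheme.regularLocus (vanishingIdeal C).subscheme)ᶜ →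
      ∑ᶠ y', pointDelta K.subscheme y' < ∑ᶠ y, pointDelta (vanishingIdeal C).subscheme y) := by
  subst hK
  set ι := (vanishingIdeal C).subschemeι with hι
  have hρ := isBlowup_lift_subschemeι_strictTransformIdeal hπ ι
  set ρ := IsClosedImmersion.lift ι ((strictTransformIdeal π (vanishingIdeal ⟨{x}, hx⟩) ι.ker).subschemeι ≫ π)
    (ker_le_ker_subschemeι_strictTransformIdeal_comp π (vanishingIdeal ⟨{x}, hx⟩) ι) with hρdef
  by_cases hsing : x ∈ ι '' (Scheme.regularLocus (vanishingIdeal C).subscheme)ᶜ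
  · -- a singular centre: `δ` drops
    obtain ⟨c, hc, hcx⟩ := hsing
    obtain ⟨h1, hndvr⟩ :=
      ringKrullDim_eq_one_and_not_isDiscreteValuationRing_of_not_mem_regularLocus hdim.le hc
    have hlt := (hρ.finsum_pointDelta_strictTransform_lt ι hx hcx hqe hdim.le h1 hndvr).2
    exact ⟨hlt.le, fun _ => hlt⟩
  · -- a regular centre point, or `x ∉ C`: the strict transform is the curve
    refine ⟨le_of_eq ?_, fun h => absurd h hsing⟩
    have hY : IsEffectiveCartier ((vanishingIdeal ⟨{x}, hx⟩).comap ι) := by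
      refine isEffectiveCartier_of_forall_mem_nonZeroDivisors fun c hc => ?_
      have hcx : ι c = x := by
        have h' : c ∈ ((((vanishingIdeal ⟨{x}, hx⟩).comap ι).support :
            Set (vanishingIdeal C).subscheme)) := hc
        rw [Scheme.IdealSheafData.support_comap, Closeds.coe_preimage, coe_support_vanishingIdeal] at h'
        exact h'
      have hreg : IsRegularLocalRing ((vanishingIdeal C).subscheme.presheaf.stalk c) := by
        by_contra hnreg
        exact hsing ⟨c, hnreg, hcx⟩
      have hcart := isEffectiveCartier_comap_vanishingIdeal_singleton ι c hx hcx hreg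
        (ringKrullDim_stalk_le_one hdim.le c)
        (fun h => not_isField_stalk_of_subschemeι_eq C hdim hx hcx
          ((IsLocalRing.isField_iff_maximalIdeal_eq).mpr h))
      obtain ⟨g, hg, hgen⟩ := hcart.exists_stalkIdeal_eq_span c
      exact ⟨g, hg, hgen⟩
    haveI : IsIso ρ := hρ.isIso hY
    have hbij : Function.Bijective ρ := (Scheme.homeoOfIso (asIso ρ)).bijective
    exact finsum_eq_of_bijective ρ hbij fun y' => pointDelta_eq_of_isIso_stalkMap ρ y'

/-- **A regular curve has `Σ δ = 0`.** [cite: Kollar2007, §1.4] -/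
theorem finsum_pointDelta_eq_zero_of_isRegular {Y : Scheme.{u}} [IsIntegral Y] (hdim : topologicalKrullDim Y = 1)
    (hreg : Scheme.IsRegular Y) : ∑ᶠ y, pointDelta Y y = 0 :=
  finsum_eq_zero_of_forall_eq_zero fun y => pointDelta_eq_zero_of_isRegularLocalRing hdim.le y (hreg y)

end CurveConfiguration

end Literature.AlgebraicGeometry.Resolution

end
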